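import Mathlib
import Summits.MatrixMultiplication.Statement
import Summits.MatrixMultiplication.MatrixMultiplication.Theorems.GraphEquationsFlatPersistence

/-!
# Persistence rigidity: three points, fibre lines, self-directions, first-order closure (`GraphEquations`, M59)

Decomp-mm node «GraphEquations» (lens 5, g42); attacked leaf `MultiplicityReduction`
(stmt-MatrixMultiplication-27806).  Target VERBATIM: `_root_.MatrixMultiplication`.  Route-neutral.

M58 identified the kernel of two horizontal rounds along `v` at `y` with the kernel vectors PERSISTING
along the base line `y + ℂv`.  This file collects the exact, everywhere-valid rigidity facts about
persistence that bound the new dial (NODE-g42 §3–4):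

* `persistsAlong_iff_three_points` — persistence along a line is membership in the kernels at THREE
  points `y − v, y, y + v` (the row map is quadratic on lines, M58 `jac_line`).
* `persistsAlong_inl_iff` / `persistsAlong_inr_iff` — along a FIBRE line (`v = (U,0)` or `(0,V)`) the row
  map is affine, so persistence is membership at TWO points, and (`PersistsAlong.add_inl`) the persistent
  `A`-directions of a kernel vector form a linear subspace.
* **`Correct.eq_zero_of_persistsAlong_self`** — SELF-DIRECTION RIGIDITY: for a correct system no nonzero
  kernel vector `δ` persists along the direction `(δ, 𝟙)` (nor `(𝟙, δ)`): the second Taylor coefficient is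
  the kernel quadric `δᵀM_iδ` (M40 `Correct.eq_zero_of_isKer_of_quad`).  The horizontal form of the quadric
  argument: every kernel vector names a line that kills it; hence (`…_of_mem_span`) any flat whose
  directions span `(δ, 𝟙)` kills `δ`, and the flat `(K(y),0) + (0,𝟙)` (corank `+ 1` directions)
  purifies at every base point.  `exists_common_ker_of_forall_line`: if EVERY line carries a persistent
  vector, the kernel family is pairwise intersecting (designs are not: NODE-g42 §3).
* **`Correct.reducedAt_of_hclosed₁_everywhere`** — FIRST-ORDER CLOSURE IS FATAL: if at EVERY base point
  every kernel vector survives one full horizontal round (is orthogonal to all first horizontal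
  derivatives), the system is reduced everywhere; equivalently (`Correct.exists_hderiv_shrinks`) a correct
  nowhere-reduced system has a base point where ONE horizontal derivative strictly shrinks the kernel (the
  pointwise shadow of the termination theorem of NODE-g42 §2, whose generic form lowers the generic corank
  by `≥ 1` per round).
Sources: [BurgisserClausenShokrollahi1997, §4.1 Rem. (4.3), (7.7), Problem 16.3];
[LeykinVerscheldeZhao2006, Thm. 3.1]; the cell's M40/M57/M58.  No `sorry`.
-/

-- dupNamespace: forced by the nested Summit.MatrixMultiplication.MatrixMultiplication layout (D-0017)
set_option linter.dupNamespace false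

noncomputable section

namespace Summit.MatrixMultiplication.MatrixMultiplication.Theorems.GraphEquations

open Matrix Module

variable {n : ℕ}

namespace AffSystem

variable {S : AffSystem n}

/-! ## Three points decide a line -/

/-- **Three points decide persistence**: `δ` persists along `y + ℂv` iff it is a kernel vector at
`y − v`, `y` and `y + v`. -/
theorem persistsAlong_iff_three_points {A B U V δ : Vec n} :
    S.PersistsAlong A B U V δ ↔
      S.IsKer (A - U) (B - V) δ ∧ S.IsKer A B δ ∧ S.IsKer (A + U) (B + V) δ := by
  constructor
  · intro h
    refine ⟨?_, by simpa using h 0, by simpa using h 1⟩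
    have := h (-1)
    simpa [sub_eq_add_neg] using this
  · rintro ⟨hm, h0, hp⟩
    refine persistsAlong_iff.mpr ⟨h0, fun i => ?_, fun i => ?_⟩ <;>
    · have h1 := hp i
      have h2 := hm i
      rw [sub_eq_add_neg, sub_eq_add_neg, ← neg_one_smul ℂ U, ← neg_one_smul ℂ V] at h2
      rw [← one_smul ℂ U, ← one_smul ℂ V] at h1
      rw [AffTest.jac_line, add_dotProduct, add_dotProduct, smul_dotProduct, smul_dotProduct, h0 i,
        zero_add, smul_eq_mul, smul_eq_mul] at h1 h2
      first
        | linear_combination (h1 - h2) / 2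
        | linear_combination (h1 + h2) / 2

/-! ## Fibre lines: two points decide -/

/-- Along an `A`-line the row map is affine: `J(A+U,B) = J(A,B) + J_{∂_{(U,0)}}(A,B)`. -/
theorem jac_add_inl (g : AffTest n) (A B U : Vec n) :
    g.jac (A + U) B = g.jac A B + (g.hderiv U 0).jac A B := by
  have := g.jac_add_add U 0 A B
  rwa [add_zero, prodVec_zero_right, mulVec_zero, add_zero] at this

/-- Along a `B`-line the row map is affine: `J(A,B+V) = J(A,B) + J_{∂_{(0,V)}}(A,B)`. -/
theorem jac_add_inr (g : AffTest n) (A B V : Vec n) :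
    g.jac A (B + V) = g.jac A B + (g.hderiv 0 V).jac A B := by
  have := g.jac_add_add 0 V A B
  rwa [add_zero, prodVec_zero_left, mulVec_zero, add_zero] at this

/-- **Two points decide an `A`-line**: `δ` persists along `(A,B) + ℂ(U,0)` iff
`δ ∈ K(A,B) ∩ K(A+U,B)`. -/
theorem persistsAlong_inl_iff {A B U δ : Vec n} :
    S.PersistsAlong A B U 0 δ ↔ S.IsKer A B δ ∧ S.IsKer (A + U) B δ := by
  rw [persistsAlong_iff]
  constructor
  · rintro ⟨h0, h1, -⟩
    exact ⟨h0, fun i => by rw [jac_add_inl, add_dotProduct, h0 i, h1 i, add_zero]⟩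
  · rintro ⟨h0, hU⟩
    refine ⟨h0, fun i => ?_, fun i => by rw [prodVec_zero_right, mulVec_zero, zero_dotProduct]⟩
    have := hU i
    rwa [jac_add_inl, add_dotProduct, h0 i, zero_add] at this

/-- **Two points decide a `B`-line**: `δ` persists along `(A,B) + ℂ(0,V)` iff
`δ ∈ K(A,B) ∩ K(A,B+V)`. -/
theorem persistsAlong_inr_iff {A B V δ : Vec n} :
    S.PersistsAlong A B 0 V δ ↔ S.IsKer A B δ ∧ S.IsKer A (B + V) δ := by
  rw [persistsAlong_iff]
  constructor
  · rintro ⟨h0, h1, -⟩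
    exact ⟨h0, fun i => by rw [jac_add_inr, add_dotProduct, h0 i, h1 i, add_zero]⟩
  · rintro ⟨h0, hV⟩
    refine ⟨h0, fun i => ?_, fun i => by rw [prodVec_zero_left, mulVec_zero, zero_dotProduct]⟩
    have := hV i
    rwa [jac_add_inr, add_dotProduct, h0 i, zero_add] at this

/-- The persistent `A`-directions of a kernel vector form a linear subspace: additivity … -/
theorem PersistsAlong.add_inl {A B U U' δ : Vec n} (h : S.PersistsAlong A B U 0 δ)
    (h' : S.PersistsAlong A B U' 0 δ) : S.PersistsAlong A B (U + U') 0 δ := by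
  rw [persistsAlong_inl_iff] at h h' ⊢
  refine ⟨h.1, fun i => ?_⟩
  have e : (S.test i).jac (A + (U + U')) B =
      (S.test i).jac (A + U) B + (S.test i).jac (A + U') B - (S.test i).jac A B := by
    rw [← add_assoc, jac_add_inl _ (A + U), jac_add_inl _ A B U, jac_add_inl _ A B U']
    have : ((S.test i).hderiv U' 0).jac (A + U) B = ((S.test i).hderiv U' 0).jac A B := by
      rw [AffTest.jac_hderiv_eq_mulVec, AffTest.jac_hderiv_eq_mulVec, mulVec_zero, mulVec_zero]
    rw [this]
    abel
  rw [e, sub_dotProduct, add_dotProduct, h.2 i, h'.2 i, h.1 i, add_zero, sub_zero]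

/-! ## Self-direction rigidity -/

/-- **No nonzero kernel vector persists along its own direction `(δ, 𝟙)`**: the second Taylor
coefficient of the row map along `(δ,𝟙)` paired with `δ` is the kernel quadric `δᵀ M_i δ`, and a
kernel vector on which all kernel quadrics vanish is `0` (M40). -/
theorem Correct.eq_zero_of_persistsAlong_self (hC : S.Correct) {A B δ : Vec n}
    (h : S.PersistsAlong A B δ idFun δ) : δ = 0 := by
  obtain ⟨h0, -, h2⟩ := persistsAlong_iff.mp h
  refine hC.eq_zero_of_isKer_of_quad h0 fun i => ?_
  have := h2 i
  rwa [prodVec_idFun] at this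

/-- `1·B = B`. -/
theorem _root_.Summit.MatrixMultiplication.MatrixMultiplication.Theorems.GraphEquations.idFun_prodVec
    (B : Vec n) : prodVec idFun B = B := by
  funext q
  obtain ⟨q₁, q₂⟩ := q
  simp only [prodVec, prodEntry, idFun, ite_mul, one_mul, zero_mul]
  simp [Finset.sum_ite_eq]

/-- The mirror statement for the direction `(𝟙, δ)`. -/
theorem Correct.eq_zero_of_persistsAlong_self' (hC : S.Correct) {A B δ : Vec n}
    (h : S.PersistsAlong A B idFun δ δ) : δ = 0 := by
  obtain ⟨h0, -, h2⟩ := persistsAlong_iff.mp h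
  refine hC.eq_zero_of_isKer_of_quad h0 fun i => ?_
  have := h2 i
  rwa [idFun_prodVec] at this

/-- Hence the two-round system along `(δ, 𝟙)` never has `δ ≠ 0` in its kernel: knowing a kernel vector
names ONE direction (of cost one matrix addition) that kills it. -/
theorem Correct.not_isKer_happend₂_self (hC : S.Correct) {A B δ : Vec n} (hδ : δ ≠ 0) :
    ¬ (S.happend₂ δ idFun).IsKer A B δ := fun h =>
  hδ (hC.eq_zero_of_persistsAlong_self (isKer_happend₂_iff.mp h))

/-- **A flat whose directions span `(δ, 𝟙)` kills `δ`.**  In particular the flat spanned by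
`(K(y), 0)` and `(0, 𝟙)` — `corank + 1` directions — carries no persistent kernel vector at any base
point of any correct system (the horizontal counterpart of generator unmasking, M52/M56). -/
theorem Correct.eq_zero_of_persistsAlongFlat_of_mem_span (hC : S.Correct) {d : ℕ} {A B δ : Vec n}
    {U V : Fin d → Vec n} (hspan : ∃ w : Fin d → ℂ, (∑ a, w a • U a) = δ ∧ (∑ a, w a • V a) = idFun)
    (h : S.PersistsAlongFlat A B U V δ) : δ = 0 := by
  obtain ⟨w, hU, hV⟩ := hspan
  have := h.line w
  rw [hU, hV] at this
  exact hC.eq_zero_of_persistsAlong_self this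

/-- If EVERY base line carries a nonzero persistent kernel vector (flat-rigidity index `≥ 2` in the
language of NODE-g42), then ANY TWO base points have a common nonzero kernel vector: the kernel family
is pairwise intersecting — the first structural constraint an obstruction to one-direction unmasking
must meet (pivot designs violate it: two generic base points share no kernel vector, M56/M57). -/
theorem exists_common_ker_of_forall_line
    (h : ∀ A B U V : Vec n, ∃ δ, δ ≠ 0 ∧ S.PersistsAlong A B U V δ) (A B A' B' : Vec n) :
    ∃ δ, δ ≠ 0 ∧ S.IsKer A B δ ∧ S.IsKer A' B' δ := by
  obtain ⟨δ, hδ, hp⟩ := h A B (A' - A) (B' - B)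
  refine ⟨δ, hδ, by simpa using hp 0, ?_⟩
  have := hp 1
  simpa using this

/-! ## First-order closure everywhere is fatal -/

/-- **If every kernel vector at every base point survives one full horizontal round, the system is
reduced everywhere.**  (Such a vector is then a kernel vector along every fibre line, hence at every
base point: a constant kernel field, impossible for a correct system, M40.) -/
theorem Correct.reducedAt_of_hclosed₁_everywhere (hC : S.Correct)
    (hcl : ∀ A B δ, S.IsKer A B δ → ∀ i U V, ((S.test i).hderiv U V).jac A B ⬝ᵥ δ = 0)
    (A B : Vec n) : S.ReducedAt A B := by
  intro δ hδ
  have hA : ∀ U, S.IsKer (A + U) B δ := fun U i => by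
    rw [jac_add_inl, add_dotProduct, hδ i, hcl A B δ hδ i U 0, add_zero]
  have hAB : ∀ U V, S.IsKer (A + U) (B + V) δ := fun U V i => by
    rw [jac_add_inr, add_dotProduct, hA U i, hcl (A + U) B δ (hA U) i 0 V, add_zero]
  by_contra hne
  refine not_correct_of_const_ker hne (fun A' B' => ?_) hC
  have := hAB (A' - A) (B' - B)
  simpa using this

/-- **Equivalently: a correct, nowhere-reduced system has a base point at which ONE horizontal
derivative strictly shrinks the kernel** (some kernel vector is not orthogonal to some first horizontal
derivative row). -/
theorem Correct.exists_hderiv_shrinks (hC : S.Correct) (hN : S.NowhereReduced) :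
    ∃ A B δ, S.IsKer A B δ ∧ ∃ i U V, ((S.test i).hderiv U V).jac A B ⬝ᵥ δ ≠ 0 := by
  by_contra h
  push Not at h
  exact hN 0 0 (hC.reducedAt_of_hclosed₁_everywhere h 0 0)

end AffSystem

end Summit.MatrixMultiplication.MatrixMultiplication.Theorems.GraphEquations

end
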